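import Summits.Ventures.YMGap.RobustBall.RobustStarDoorW
import Summits.Ventures.YMGap.RobustBall.TorusDoorVariance
import HarnessLib

/-!
# Venture YMGap, track ROBUST-BALL (Y2) — crux Y2-X2 / Y2-X2-W, VARIANCE FORM: the robust vertex-star door (tiers 1 and 2)
# on a one-link POINCARÉ × VARIANCE pair — the route whose numbers are UNIFORM IN `N`

HONEST FRAMING. WHAT THIS IS: a venture file (cell `pub-ymgap`, track Y2 ROBUST-BALL, seat ds-2): the two robust star doors of the
seat (`RobustStarDoor.clustersWith_of_robustStar`, finite range, Dobrushin–Shlosman profile; `RobustStarDoorW.clustersWith_of_robustStarW`,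
weighted ball, weighted iteration) re-run on ds-2 g6's VARIANCE-FORM single-link matrix (`TorusDoorVariance`:
`e^{a}√(c_P v)(|β|/N)·n(e,y) + e^{a/2}√c_P·ℓ(e,y)` from `OneLinkPoincareSUN N b c_P` and `OneLinkVarianceBound N b v` on `b ≥ 2(d−1)|β|/N`)
instead of the Kantorovich modulus (`K e^{a}(1 + 2√N ℓ_s)(|β|/N)·n + √N·ℓ`). Fed with the tree's all-`N` Bakry–Émery pair
`(c_P, v) = (1/(N(1/2−b)), N/(1/2−b))` the robust coefficient is `e^{ε₀}·t/(1/2−b)` ('t Hooft `t = |β|/N`) and the off-column rows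
`e^{ε₀/2} ε₁/√(N(1/2−b)) ≤ e^{ε₀/2} ε₁/√(2(1/2−b))` — DECREASING in `N`, so ONE certificate serves EVERY `N ≥ 2` (rows file
`TorusRowsSUNStar`). Outputs: `clustersWith_of_robustStar_variance` (tier 1 ⇒ `ClustersWith` with the profile constants),
`clustersWith_of_robustStarW_variance` (tier 2, rate `t`), and the ball wrappers `torusClusteringOnBallUpTo_of_robustStar_variance`,
`torusClusteringOnBallW_upTo_of_robustStar_variance` + Y4's `d = 3` bridges. WHAT THIS IS NOT: no number here; radii/rates are door
artefacts; strong-coupling lattice statements on finite tori — nothing about the continuum limit or the Millennium problem.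

## References
* R. Holley, D. Stroock (1987) (the `e^{osc}` factor); D. Bakry, M. Émery (1985); the tree: `TorusDoorVariance` (g6), `RobustStarDoor`
  (g7), `RobustStarDoorW` (g9), `TorusDoorSUN` (p1, the `N`-uniform single-link rows).
-/

noncomputable section

open MeasureTheory ProbabilityTheory Function Finset
open Literature.Probability.LatticeModels
open Literature.Probability.LatticeModels.DobrushinMetric
open Literature.MathematicalPhysics.QuantumLattice (fundamentalRep)
open Literature.MathematicalPhysics.QuantumFieldTheory hiding ZdEdge
open Literature.MathematicalPhysics.QuantumFieldTheory.Balaban1983to89.StrongCouplingTorusWindow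
open Summit.QuantumFields.BalabanUV.InfraRed.StrongCouplingPoincareDoorSUN (OneLinkPoincareSUN)
open Summit.QuantumFields.BalabanUV.InfraRed.StrongCouplingVarianceDoorSUN (OneLinkVarianceBound)
open Summit.Ventures.YMGap.DSWindow
open Summit.Ventures.YMGap.StarKernel
open Summit.Ventures.YMGap.StarResolventDim (Delta gaugeR doorPoly Delta_pos_of_door gaugeR_lt_one_of_door)
open Summit.Ventures.YMGap.StarLemmaGDim
open Summit.Ventures.YMGap.RobustStar

namespace Summit.Ventures.YMGap.RobustBall

variable {d L N : ℕ} [NeZero L]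

/-! ### Tier 1 (finite range, Dobrushin–Shlosman profile), variance form -/


/-- **THE ROBUST STAR DOOR FOR ONE TIER-1 MEMBER, VARIANCE FORM ⇒ `ClustersWith`.** The single-link matrix is ds-2 g6's
variance-form matrix `e^{a}√(c_P v)(|β|/N)·n(e,y) + e^{a/2}√c_P·ℓ(e,y)` from a one-link Poincaré constant `c_P` and a variance
bound `v` on the radius `b ≥ 2(d−1)|β|/N` (`OneLinkPoincareSUN`, `OneLinkVarianceBound` — e.g. the all-`N` Bakry–Émery pair); the
robust coefficient is any `c ≥ e^{ε₀}√(c_P v)|β|/N` and the off-column rows are `λ ≥ e^{ε₀/2}√c_P ε₁` (NO `√N`: the route that is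
uniform in `N`). Constants as in `RobustStarDoor.clustersWith_of_robustStar`. [folklore] -/
theorem clustersWith_of_robustStar_variance (hd : 2 ≤ d) (hN : 1 ≤ N) (hL : 3 ≤ L) {β ε₀ ε₁ b cP v c lam θ ρ : ℝ}
    {r Kn : ℕ} (hcP : 0 ≤ cP) (hv : 0 ≤ v) (hb : |β| / N * (2 * ((d : ℝ) - 1)) ≤ b) (hP : OneLinkPoincareSUN N b cP)
    (hVB : OneLinkVarianceBound N b v) (hε₁ : 0 ≤ ε₁)
    (hc : Real.exp ε₀ * Real.sqrt (cP * v) * (|β| / N) ≤ c) (hlam : Real.exp (ε₀ / 2) * Real.sqrt cP * ε₁ ≤ lam)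
    (hθ : θ = (2 * (d : ℝ) - 2) * c + lam) (hθ1 : θ < 1) (hcd : doorPoly d c < 1)
    (hρ : ρ = gaugeR d c + (lam + θ ^ Kn * (4 * d * lam)) / (1 - θ)) (hρ1 : ρ < 1)
    {W : Perturbation d L N} (hW : W ∈ ClusterDomainFR ε₀ ε₁ r) :
    ClustersWith W β
      (4 * (2 * Real.sqrt N) ^ 2 * Real.exp (2 * ((1 - ρ) ^ 2 / (2 * (2 * ρ * (2 * d : ℕ) + 1)))))
      ((1 - ρ) ^ 2 / (2 * (2 * ρ * (2 * d : ℕ) + 1)) / ((max r 1 + 2 : ℕ) : ℝ)) := by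
  classical
  obtain ⟨hr, w, hwa, hwℓ⟩ := exists_witness_of_mem_clusterDomainFR hW
  have hL1 : 1 < L := by omega
  have hd1 : 1 ≤ d := by omega
  have hc0 : 0 ≤ c := le_trans (by positivity) hc
  have hlam0 : 0 ≤ lam := le_trans (by positivity) hlam
  have hΔ : 0 < Delta d c := Delta_pos_of_door hd hc0 hcd
  have hgR : 0 ≤ gaugeR d c ∧ gaugeR d c < 1 := gaugeR_lt_one_of_door hd hc0 hcd
  have hd2 : (2 : ℝ) ≤ d := by exact_mod_cast hd
  have hθ0 : 0 ≤ θ := by rw [hθ]; nlinarith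
  have h1θ : 0 < 1 - θ := by linarith
  have hρ0 : 0 ≤ ρ := by
    rw [hρ]
    refine add_nonneg hgR.1 (div_nonneg (add_nonneg hlam0 ?_) h1θ.le)
    have : 0 ≤ θ ^ Kn := pow_nonneg hθ0 Kn
    positivity
  -- the robust single-link matrix, extended to all links with the off-column array `E`
  set nbr : Edge d L → Finset (Edge d L) := fun e => (univ.erase e).filter fun y => torusNorm (e.1 - y.1) ≤ max r 1
    with hnbr
  set E : Edge d L → Edge d L → ℝ := fun x z =>
    if z ∈ nbr x then Real.exp (w.oscLoad 0 x / 2) * Real.sqrt cP * w.crossLip 0 x z else 0 with hEdef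
  have hE0 : ∀ x z, 0 ≤ E x z := fun x z => by
    simp only [hEdef]; split_ifs
    · exact mul_nonneg (by positivity) (crossLip_nonneg w 0 x z)
    · exact le_rfl
  have hKR := isKRContraction_perturbedTorusSpec_variance_of_hasRange hd1 hN hL1 hcP hv hb hP hVB w hr
  have hcoef : ∀ x : Edge d L, Real.exp (w.oscLoad 0 x) * Real.sqrt (cP * v) * (|β| / N) ≤ c := by
    intro x
    refine le_trans ?_ hc
    have h1 : Real.exp (w.oscLoad 0 x) ≤ Real.exp ε₀ := Real.exp_le_exp.2 (hwa x)
    gcongr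
  have hea2 : ∀ x : Edge d L, Real.exp (w.oscLoad 0 x / 2) ≤ Real.exp (ε₀ / 2) := fun x =>
    Real.exp_le_exp.2 (by linarith [hwa x])
  have hKR' : IsKRContraction (perturbedTorusSpec W β) suFrobDist (fun e => univ.erase e) (Cst c E) := by
    refine isKRContraction_univ_of_le hKR (fun a b => suFrobDist_nonneg a b) (Cst_nonneg hc0 hE0) fun x y hy => ?_
    have hEy : E x y = Real.exp (w.oscLoad 0 x / 2) * Real.sqrt cP * w.crossLip 0 x y := by
      simp only [hEdef]; exact if_pos hy
    have ht : (0 : ℝ) ≤ tInfluence x y := Nat.cast_nonneg _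
    simp only [Cst]
    rw [hEy]
    nlinarith [mul_nonneg (sub_nonneg.2 (hcoef x)) ht]
  have hlamrow : ∀ x, ∑ z ∈ univ.erase x, E x z ≤ lam := by
    intro x
    calc ∑ z ∈ univ.erase x, E x z ≤ ∑ z ∈ univ.erase x, Real.exp (w.oscLoad 0 x / 2) * Real.sqrt cP * w.crossLip 0 x z :=
          sum_le_sum fun z _ => by
            simp only [hEdef]; split_ifs
            · exact le_rfl
            · exact mul_nonneg (by positivity) (crossLip_nonneg w 0 x z)
      _ = Real.exp (w.oscLoad 0 x / 2) * Real.sqrt cP * w.crossLipLoad 0 x := by rw [← mul_sum]; rfl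
      _ ≤ Real.exp (ε₀ / 2) * Real.sqrt cP * ε₁ := by
          refine mul_le_mul (mul_le_mul_of_nonneg_right (hea2 x) (Real.sqrt_nonneg _)) ?_ (crossLipLoad_nonneg w 0 x)
            (by positivity)
          linarith [hwℓ x, selfLipLoad_nonneg w 0 x]
      _ ≤ lam := hlam
  have hrow : ∀ (s : Site d L), ∀ x ∈ vertexStar s, ∑ z ∈ (vertexStar s).erase x, Cst c E x z ≤ θ := by
    intro s x hx; rw [hθ]; exact sum_star_erase_Cst_le hL hc0 hE0 hlamrow hx
  -- (H1), (H2), support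
  have hcontract := robust_star_window (W := W) (β := β) hd hL hc0 hΔ hE0 hθ0 hθ1 hrow hKR' Kn
  have hsum : ∀ (s : Site d L) (x : Edge d L), x ∈ vertexStar s → ∑ y, Krob c E θ Kn s y x ≤ ρ := by
    intro s x hx; rw [hρ]; exact sum_Krob_le hd hL hc0 hΔ hgR.2.le hE0 hlamrow hθ0 hθ1 (hrow s) hx
  have hKloc : ∀ (s : Site d L) (y x : Edge d L), Krob c E θ Kn s y x ≠ 0 →
      ∀ w' ∈ linkEnds y, torusNorm (s - w') ≤ (max r 1 + 2 : ℕ) := by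
    intro s y x hk w' hw'
    have hyw : torusNorm (y.1 - w') ≤ 1 := torusNorm_fst_sub_linkEnds_le_one hw'
    rcases mem_starBoundary_or_of_Krob_ne_zero hk with hyb | ⟨x', hx', hE'⟩
    · have := torusNorm_le_one_of_mem_starBoundary hyb hw'
      omega
    · have hyn : y ∈ nbr x' := by
        by_contra h
        exact hE' (by simp only [hEdef, if_neg h])
      have hxy : torusNorm (x'.1 - y.1) ≤ max r 1 := (mem_filter.1 hyn).2
      have hsx : torusNorm (s - x'.1) ≤ 1 := torusNorm_sub_fst_le_one_of_mem_vertexStar hx'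
      have t1 := torusNorm_sub_le s x'.1 y.1
      have t2 := torusNorm_sub_le s y.1 w'
      omega
  -- the covariance bound for the member's torus measure
  intro F G ΔF ΔG δF δG n hFm hGm hFdep hGdep hFb hGb hFlip hGlip hdist
  set κ : ℝ := (1 - ρ) ^ 2 / (2 * (2 * ρ * (2 * d : ℕ) + 1)) with hκ
  have hFobs : LinkObs suFrobDist F ΔF δF := ⟨hFm, hFb, hFdep, hFlip.nonneg, hFlip.le⟩
  have hGobs : LinkObs suFrobDist G ΔG δG := ⟨hGm, hGb, hGdep, hGlip.nonneg, hGlip.le⟩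
  have hL₀ : ∀ x ∈ ΔF, ∀ z ∈ ΔG, ∀ a ∈ linkEnds x, ∀ w' ∈ linkEnds z, n - 2 ≤ torusNorm (a - w') :=
    fun x hx z hz a ha w' hw' => le_torusNorm_linkEnds_sub (hdist x hx z hz) ha hw'
  have key := spec_star_abs_covariance_le (isSpecification_perturbedTorusSpec W β)
    (isGibbsMeasure_perturbedMeasure W β) (r := suFrobDist) (R := 2 * Real.sqrt N) (by positivity)
    (fun p q => suFrobDist_le p q) (fun s y x => Krob_nonneg hd hc0 hΔ hE0 hθ0 hθ1 Kn s y x)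
    (ρ₀ := max r 1 + 2) (by omega) hKloc hcontract hρ0 hρ1 hsum hFobs hGobs (n - 2) hL₀
  refine key.trans ?_
  have hκ0 : 0 ≤ κ := by rw [hκ]; have := hρ0; positivity
  have hδF : 0 ≤ ∑ x ∈ ΔF, δF x := Finset.sum_nonneg fun x _ => hFlip.nonneg x
  have hδG : 0 ≤ ∑ y ∈ ΔG, δG y := Finset.sum_nonneg fun y _ => hGlip.nonneg y
  -- depth `⌊(n−2)/ρ₀⌋ ≥ n/ρ₀ − 2`
  set ρ₀ : ℕ := max r 1 + 2 with hρ₀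
  have hρ₀2 : (2 : ℝ) ≤ ρ₀ := by
    have : 2 ≤ ρ₀ := by omega
    exact_mod_cast this
  have hρ₀pos : (0 : ℝ) < ρ₀ := by linarith
  have hq : (n : ℝ) / ρ₀ - 2 ≤ (((n - 2) / ρ₀ : ℕ) : ℝ) := by
    have hdm := Nat.div_add_mod (n - 2) ρ₀
    have hml := Nat.mod_lt (n - 2) (show 0 < ρ₀ by omega)
    have h1 : ((n - 2 : ℕ) : ℝ) < ρ₀ * (((n - 2) / ρ₀ : ℕ) : ℝ) + ρ₀ := by
      have : (n - 2 : ℕ) < ρ₀ * ((n - 2) / ρ₀) + ρ₀ := by omega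
      exact_mod_cast this
    have h2 : (n : ℝ) - 2 ≤ ((n - 2 : ℕ) : ℝ) := by
      rcases Nat.lt_or_ge n 2 with h | h
      · rw [Nat.sub_eq_zero_of_le h.le]
        have : (n : ℝ) < 2 := by exact_mod_cast h
        simp; linarith
      · rw [Nat.cast_sub h]; push_cast; exact le_rfl
    have h3 : (n : ℝ) ≤ ρ₀ * (((n - 2) / ρ₀ : ℕ) : ℝ) + 2 * ρ₀ := by linarith
    have h4 : (n : ℝ) / ρ₀ ≤ (((n - 2) / ρ₀ : ℕ) : ℝ) + 2 := by
      rw [div_le_iff₀ hρ₀pos]; linarith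
    linarith
  have hexp : Real.exp (-(κ * (((n - 2) / ρ₀ : ℕ) : ℝ))) ≤ Real.exp (2 * κ) * Real.exp (-(κ / ρ₀) * n) := by
    rw [← Real.exp_add]
    refine Real.exp_le_exp.2 ?_
    have : κ * ((n : ℝ) / ρ₀ - 2) ≤ κ * (((n - 2) / ρ₀ : ℕ) : ℝ) := mul_le_mul_of_nonneg_left hq hκ0
    have e : -(κ / ρ₀) * n = -(κ * ((n : ℝ) / ρ₀)) := by ring
    rw [e]; nlinarith
  calc 4 * (2 * Real.sqrt N) ^ 2 * Real.exp (-(κ * (((n - 2) / ρ₀ : ℕ) : ℝ))) * (∑ x ∈ ΔF, δF x) * ∑ y ∈ ΔG, δG y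
      ≤ 4 * (2 * Real.sqrt N) ^ 2 * (Real.exp (2 * κ) * Real.exp (-(κ / ρ₀) * n)) * (∑ x ∈ ΔF, δF x) *
          ∑ y ∈ ΔG, δG y := by gcongr
    _ = 4 * (2 * Real.sqrt N) ^ 2 * Real.exp (2 * κ) * (∑ y ∈ ΔG, δG y) * (∑ x ∈ ΔF, δF x) *
          Real.exp (-(κ / ρ₀) * n) := by ring

/-! ### Tier 2 (weighted ball, weighted iteration), variance form -/

/-- **THE ROBUST STAR DOOR FOR ONE TIER-2 MEMBER, VARIANCE FORM ⇒ `ClustersWith` AT RATE `t`** (`0 ≤ t ≤ κ`): as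
`RobustStarDoorW.clustersWith_of_robustStarW` with the variance-form single-link matrix (`c ≥ e^{ε₀}√(c_P v)|β|/N`,
`λ ≥ e^{ε₀/2}√c_P ε₁`). [folklore] -/
theorem clustersWith_of_robustStarW_variance (hd : 2 ≤ d) (hN : 1 ≤ N) (hL : 3 ≤ L) {β κ ε₀ ε₁ b cP v c lam θ ρ t : ℝ}
    {Kn : ℕ} (hcP : 0 ≤ cP) (hv : 0 ≤ v) (hb : |β| / N * (2 * ((d : ℝ) - 1)) ≤ b) (hP : OneLinkPoincareSUN N b cP)
    (hVB : OneLinkVarianceBound N b v) (hε₁ : 0 ≤ ε₁) (ht : 0 ≤ t) (htκ : t ≤ κ)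
    (hc : Real.exp ε₀ * Real.sqrt (cP * v) * (|β| / N) ≤ c) (hlam : Real.exp (ε₀ / 2) * Real.sqrt cP * ε₁ ≤ lam)
    (hθ : θ = (2 * (d : ℝ) - 2) * c + lam) (hθ1 : θ < 1) (hcd : doorPoly d c < 1)
    (hρ : ρ = Real.exp t * (gaugeR d c +
      (Real.exp (2 * t) * lam + θ ^ Kn * (4 * d * (Real.exp (2 * t) * lam))) / (1 - θ))) (hρ1 : ρ < 1)
    {W : Perturbation d L N} (hW : W ∈ ClusterDomain κ ε₀ ε₁) :
    ClustersWith W β (2 * (2 * Real.sqrt N) ^ 2 * Real.exp (2 * t)) t := by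
  classical
  obtain ⟨w, hwa, hwℓ⟩ := exists_witness_of_mem_clusterDomain hW
  have hκ : 0 ≤ κ := ht.trans htκ
  have hL1 : 1 < L := by omega
  have hd1 : 1 ≤ d := by omega
  have hc0 : 0 ≤ c := le_trans (by positivity) hc
  have hlam0 : 0 ≤ lam := le_trans (by positivity) hlam
  have hΔ : 0 < Delta d c := Delta_pos_of_door hd hc0 hcd
  have hgR : 0 ≤ gaugeR d c ∧ gaugeR d c < 1 := gaugeR_lt_one_of_door hd hc0 hcd
  have hd2 : (2 : ℝ) ≤ d := by exact_mod_cast hd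
  have hθ0 : 0 ≤ θ := by rw [hθ]; nlinarith
  have h1θ : 0 < 1 - θ := by linarith
  have het : 1 ≤ Real.exp t := Real.one_le_exp ht
  have hρ0 : 0 ≤ ρ := by
    rw [hρ]
    refine mul_nonneg (Real.exp_pos _).le (add_nonneg hgR.1 (div_nonneg (add_nonneg (by positivity) ?_) h1θ.le))
    have : 0 ≤ θ ^ Kn := pow_nonneg hθ0 Kn
    positivity
  -- the robust single-link matrix with the (range-free) off-column array `E`
  set E : Edge d L → Edge d L → ℝ := fun x z => Real.exp (w.oscLoad 0 x / 2) * Real.sqrt cP * w.crossLip 0 x z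
    with hEdef
  have hE0 : ∀ x z, 0 ≤ E x z := fun x z => mul_nonneg (by positivity) (crossLip_nonneg w 0 x z)
  have hKR := isKRContraction_perturbedTorusSpec_variance hd1 hN hL1 hcP hv hb hP hVB w (β := β)
  have hea : ∀ x : Edge d L, Real.exp (w.oscLoad 0 x) ≤ Real.exp ε₀ := fun x =>
    Real.exp_le_exp.2 ((oscLoad_zero_le w hκ x).trans (hwa x))
  have hea2 : ∀ x : Edge d L, Real.exp (w.oscLoad 0 x / 2) ≤ Real.exp (ε₀ / 2) := fun x =>
    Real.exp_le_exp.2 (by linarith [(oscLoad_zero_le w hκ x).trans (hwa x)])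
  have hcoef : ∀ x : Edge d L, Real.exp (w.oscLoad 0 x) * Real.sqrt (cP * v) * (|β| / N) ≤ c := by
    intro x
    refine le_trans ?_ hc
    have h1 := hea x
    gcongr
  have hKR' : IsKRContraction (perturbedTorusSpec W β) suFrobDist (fun e => univ.erase e) (Cst c E) := by
    refine isKRContraction_univ_of_le hKR (fun a b => suFrobDist_nonneg a b) (Cst_nonneg hc0 hE0) fun x y _ => ?_
    have ht' : (0 : ℝ) ≤ tInfluence x y := Nat.cast_nonneg _
    simp only [Cst, hEdef]
    nlinarith [mul_nonneg (sub_nonneg.2 (hcoef x)) ht']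
  have hlamrow : ∀ x, ∑ z ∈ univ.erase x, E x z ≤ lam := by
    intro x
    calc ∑ z ∈ univ.erase x, E x z = Real.exp (w.oscLoad 0 x / 2) * Real.sqrt cP * w.crossLipLoad 0 x := by
          rw [hEdef, ← mul_sum]; rfl
      _ ≤ Real.exp (ε₀ / 2) * Real.sqrt cP * ε₁ := by
          refine mul_le_mul (mul_le_mul_of_nonneg_right (hea2 x) (Real.sqrt_nonneg _)) ?_ (crossLipLoad_nonneg w 0 x)
            (by positivity)
          linarith [crossLipLoad_mono w hκ x, hwℓ x, selfLipLoad_nonneg w κ x]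
      _ ≤ lam := hlam
  have hrow : ∀ (s : Site d L), ∀ x ∈ vertexStar s, ∑ z ∈ (vertexStar s).erase x, Cst c E x z ≤ θ := by
    intro s x hx; rw [hθ]; exact sum_star_erase_Cst_le hL hc0 hE0 hlamrow hx
  -- (H1) and the WEIGHTED (H2) with the reach weight `e^{t·reach(s,y)}`
  have hcontract := robust_star_window (W := W) (β := β) hd hL hc0 hΔ hE0 hθ0 hθ1 hrow hKR' Kn
  have hsumw : ∀ (s : Site d L) (x : Edge d L), x ∈ vertexStar s →
      ∑ y, Krob c E θ Kn s y x * Real.exp (t * (((linkEnds y).sup fun w => torusNorm (s - w) : ℕ) : ℝ)) ≤ ρ := by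
    intro s x hx
    have hφ1 : ∀ y : Edge d L, 1 ≤ Real.exp (t * (((linkEnds y).sup fun w => torusNorm (s - w) : ℕ) : ℝ)) :=
      fun y => Real.one_le_exp (mul_nonneg ht (Nat.cast_nonneg _))
    have hΦb : ∀ y ∈ starBoundary s,
        Real.exp (t * (((linkEnds y).sup fun w => torusNorm (s - w) : ℕ) : ℝ)) ≤ Real.exp t := by
      intro y hy
      refine Real.exp_le_exp.2 ?_
      have h1 : ((linkEnds y).sup fun w => torusNorm (s - w)) ≤ 1 :=
        Finset.sup_le fun w hw => torusNorm_le_one_of_mem_starBoundary hy hw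
      have h1' : (((linkEnds y).sup fun w => torusNorm (s - w) : ℕ) : ℝ) ≤ 1 := by exact_mod_cast h1
      nlinarith
    have hlamφ : ∀ x ∈ vertexStar s, ∑ z ∈ univ.erase x,
        E x z * Real.exp (t * (((linkEnds z).sup fun w => torusNorm (s - w) : ℕ) : ℝ)) ≤ Real.exp (2 * t) * lam := by
      intro x hx
      have h1 := sum_erase_crossLip_mul_exp_reach_le w ht hx
      have hq : 0 ≤ Real.exp (w.oscLoad 0 x / 2) * Real.sqrt cP := by positivity
      calc ∑ z ∈ univ.erase x, E x z * Real.exp (t * (((linkEnds z).sup fun w => torusNorm (s - w) : ℕ) : ℝ))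
          = Real.exp (w.oscLoad 0 x / 2) * Real.sqrt cP * ∑ z ∈ univ.erase x, w.crossLip 0 x z *
              Real.exp (t * (((linkEnds z).sup fun w => torusNorm (s - w) : ℕ) : ℝ)) := by
            rw [hEdef, mul_sum]; exact sum_congr rfl fun z _ => by ring
        _ ≤ Real.exp (w.oscLoad 0 x / 2) * Real.sqrt cP * (Real.exp (2 * t) * w.crossLipLoad t x) :=
            mul_le_mul_of_nonneg_left h1 hq
        _ ≤ Real.exp (ε₀ / 2) * Real.sqrt cP * (Real.exp (2 * t) * ε₁) := by
            refine mul_le_mul (mul_le_mul_of_nonneg_right (hea2 x) (Real.sqrt_nonneg _))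
              (mul_le_mul_of_nonneg_left ?_ (Real.exp_pos _).le)
              (mul_nonneg (Real.exp_pos _).le (crossLipLoad_nonneg w t x)) (by positivity)
            linarith [crossLipLoad_mono w htκ x, hwℓ x, selfLipLoad_nonneg w κ x]
        _ = Real.exp (2 * t) * (Real.exp (ε₀ / 2) * Real.sqrt cP * ε₁) := by ring
        _ ≤ Real.exp (2 * t) * lam := mul_le_mul_of_nonneg_left hlam (Real.exp_pos _).le
    rw [hρ]
    exact sum_Krob_mul_le' hd hL hc0 hΔ hgR.2.le hE0 hθ0 hθ1 (hrow s) hφ1 hΦb het hlamφ hx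
  -- the covariance bound for the member's torus measure
  intro F G ΔF ΔG δF δG n hFm hGm hFdep hGdep hFb hGb hFlip hGlip hdist
  have hFobs : LinkObs suFrobDist F ΔF δF := ⟨hFm, hFb, hFdep, hFlip.nonneg, hFlip.le⟩
  have hGobs : LinkObs suFrobDist G ΔG δG := ⟨hGm, hGb, hGdep, hGlip.nonneg, hGlip.le⟩
  have hL₀ : ∀ x ∈ ΔF, ∀ z ∈ ΔG, ∀ a ∈ linkEnds x, ∀ w' ∈ linkEnds z, n - 2 ≤ torusNorm (a - w') :=
    fun x hx z hz a ha w' hw' => le_torusNorm_linkEnds_sub (hdist x hx z hz) ha hw'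
  have key := spec_star_abs_covariance_le_weighted (isSpecification_perturbedTorusSpec W β)
    (isGibbsMeasure_perturbedMeasure W β) (r := suFrobDist) (R := 2 * Real.sqrt N) (by positivity)
    (fun p q => suFrobDist_le p q) (fun s y x => Krob_nonneg hd hc0 hΔ hE0 hθ0 hθ1 Kn s y x)
    hcontract hρ0 hρ1 ht hsumw hFobs hGobs (n - 2) hL₀
  refine key.trans ?_
  have hδF : 0 ≤ ∑ x ∈ ΔF, δF x := Finset.sum_nonneg fun x _ => hFlip.nonneg x
  have hδG : 0 ≤ ∑ y ∈ ΔG, δG y := Finset.sum_nonneg fun y _ => hGlip.nonneg y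
  have hn : (n : ℝ) - 2 ≤ ((n - 2 : ℕ) : ℝ) := by
    rcases Nat.lt_or_ge n 2 with h | h
    · rw [Nat.sub_eq_zero_of_le h.le]
      have : (n : ℝ) < 2 := by exact_mod_cast h
      simp; linarith
    · rw [Nat.cast_sub h]; push_cast; exact le_rfl
  have hexp : Real.exp (-(t * ((n - 2 : ℕ) : ℝ))) ≤ Real.exp (2 * t) * Real.exp (-t * n) := by
    rw [← Real.exp_add]
    refine Real.exp_le_exp.2 ?_
    nlinarith
  calc 2 * (2 * Real.sqrt N) ^ 2 * Real.exp (-(t * ((n - 2 : ℕ) : ℝ))) * (∑ x ∈ ΔF, δF x) * ∑ y ∈ ΔG, δG y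
      ≤ 2 * (2 * Real.sqrt N) ^ 2 * (Real.exp (2 * t) * Real.exp (-t * n)) * (∑ x ∈ ΔF, δF x) * ∑ y ∈ ΔG, δG y := by
        gcongr
    _ = 2 * (2 * Real.sqrt N) ^ 2 * Real.exp (2 * t) * (∑ y ∈ ΔG, δG y) * (∑ x ∈ ΔF, δF x) *
          Real.exp (-t * n) := by ring

/-! ### The balls: up-to-`β⋆` currencies and Y4's `d = 3` bridges, variance form -/

/-- **Tier 1, variance form, UP TO `β⋆`** (`TorusClusteringOnBallUpTo`): a pair on the radius `b ≥ 2(d−1)β⋆/N` serves every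
`0 ≤ β ≤ β⋆` (the tree's one-link predicates are monotone in the radius through `hb`). [folklore] -/
theorem torusClusteringOnBallUpTo_of_robustStar_variance (hd : 2 ≤ d) (hN : 1 ≤ N) {βs ε₀ ε₁ b cP v c lam θ ρ : ℝ}
    (r : ℕ) (Kn : ℕ) (hcP : 0 ≤ cP) (hv : 0 ≤ v) (hb : βs / N * (2 * ((d : ℝ) - 1)) ≤ b) (hP : OneLinkPoincareSUN N b cP)
    (hVB : OneLinkVarianceBound N b v) (hε₁ : 0 ≤ ε₁) (hc : Real.exp ε₀ * Real.sqrt (cP * v) * (βs / N) ≤ c)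
    (hlam : Real.exp (ε₀ / 2) * Real.sqrt cP * ε₁ ≤ lam) (hθ : θ = (2 * (d : ℝ) - 2) * c + lam) (hθ1 : θ < 1)
    (hcd : doorPoly d c < 1) (hρ : ρ = gaugeR d c + (lam + θ ^ Kn * (4 * d * lam)) / (1 - θ)) (hρ1 : ρ < 1) :
    TorusClusteringOnBallUpTo N d βs ε₀ ε₁ r
      (4 * (2 * Real.sqrt N) ^ 2 * Real.exp (2 * ((1 - ρ) ^ 2 / (2 * (2 * ρ * (2 * d : ℕ) + 1)))))
      ((1 - ρ) ^ 2 / (2 * (2 * ρ * (2 * d : ℕ) + 1)) / ((max r 1 + 2 : ℕ) : ℝ)) := by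
  intro β hβ0 hββs L _ hL W hW
  have hβ : |β| ≤ βs := by rw [abs_of_nonneg hβ0]; exact hββs
  have hN0 : (0 : ℝ) ≤ N := Nat.cast_nonneg _
  have hd2 : (2 : ℝ) ≤ d := by exact_mod_cast hd
  have hdiv : |β| / N ≤ βs / N := div_le_div_of_nonneg_right hβ hN0
  have hb' : |β| / N * (2 * ((d : ℝ) - 1)) ≤ b := le_trans (by nlinarith) hb
  have hc' : Real.exp ε₀ * Real.sqrt (cP * v) * (|β| / N) ≤ c :=
    le_trans (mul_le_mul_of_nonneg_left hdiv (by positivity)) hc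
  exact clustersWith_of_robustStar_variance hd hN hL hcP hv hb' hP hVB hε₁ hc' hlam hθ hθ1 hcd hρ hρ1 hW

/-- **Tier 2, variance form, UP TO `β⋆`** (`TorusClusteringOnBallW` at every `0 ≤ β ≤ β⋆`, rate `t`, constant `2(2√N)²e^{2t}`). [folklore] -/
theorem torusClusteringOnBallW_upTo_of_robustStar_variance (hd : 2 ≤ d) (hN : 1 ≤ N) {βs κ ε₀ ε₁ b cP v c lam θ ρ t : ℝ}
    (Kn : ℕ) (hcP : 0 ≤ cP) (hv : 0 ≤ v) (hb : βs / N * (2 * ((d : ℝ) - 1)) ≤ b) (hP : OneLinkPoincareSUN N b cP)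
    (hVB : OneLinkVarianceBound N b v) (hε₁ : 0 ≤ ε₁) (ht : 0 ≤ t) (htκ : t ≤ κ)
    (hc : Real.exp ε₀ * Real.sqrt (cP * v) * (βs / N) ≤ c) (hlam : Real.exp (ε₀ / 2) * Real.sqrt cP * ε₁ ≤ lam)
    (hθ : θ = (2 * (d : ℝ) - 2) * c + lam) (hθ1 : θ < 1) (hcd : doorPoly d c < 1)
    (hρ : ρ = Real.exp t * (gaugeR d c +
      (Real.exp (2 * t) * lam + θ ^ Kn * (4 * d * (Real.exp (2 * t) * lam))) / (1 - θ))) (hρ1 : ρ < 1) :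
    ∀ β : ℝ, 0 ≤ β → β ≤ βs → TorusClusteringOnBallW N d β κ ε₀ ε₁ (2 * (2 * Real.sqrt N) ^ 2 * Real.exp (2 * t)) t := by
  intro β hβ0 hββs L _ hL W hW
  have hβ : |β| ≤ βs := by rw [abs_of_nonneg hβ0]; exact hββs
  have hN0 : (0 : ℝ) ≤ N := Nat.cast_nonneg _
  have hd2 : (2 : ℝ) ≤ d := by exact_mod_cast hd
  have hdiv : |β| / N ≤ βs / N := div_le_div_of_nonneg_right hβ hN0
  have hb' : |β| / N * (2 * ((d : ℝ) - 1)) ≤ b := le_trans (by nlinarith) hb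
  have hc' : Real.exp ε₀ * Real.sqrt (cP * v) * (|β| / N) ≤ c :=
    le_trans (mul_le_mul_of_nonneg_left hdiv (by positivity)) hc
  exact clustersWith_of_robustStarW_variance hd hN hL hcP hv hb' hP hVB hε₁ ht htκ hc' hlam hθ hθ1 hcd hρ hρ1 hW

/-- **Y4, `d = 3`, tier 1, variance form**: `ClusterDomainClustering` on `ClusterDomainFR ε₀ ε₁ r` up to `β⋆`. [folklore] -/
theorem clusterDomainClustering_dim3_of_robustStar_variance (hN : 1 ≤ N) {βs ε₀ ε₁ b cP v c lam θ ρ : ℝ}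
    (r : ℕ) (Kn : ℕ) (hcP : 0 ≤ cP) (hv : 0 ≤ v) (hb : βs / N * 4 ≤ b) (hP : OneLinkPoincareSUN N b cP)
    (hVB : OneLinkVarianceBound N b v) (hε₁ : 0 ≤ ε₁) (hc : Real.exp ε₀ * Real.sqrt (cP * v) * (βs / N) ≤ c)
    (hlam : Real.exp (ε₀ / 2) * Real.sqrt cP * ε₁ ≤ lam) (hθ : θ = 4 * c + lam) (hθ1 : θ < 1) (hcd : doorPoly 3 c < 1)
    (hρ : ρ = gaugeR 3 c + (lam + θ ^ Kn * (12 * lam)) / (1 - θ)) (hρ1 : ρ < 1) :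
    YM3IR.ClusterDomainClustering (G := SUN N)
      ⟨fundamentalRep (Fin N), βs, fun _ _ W => W ∈ ClusterDomainFR ε₀ ε₁ r⟩ suFrobDist
      ((1 - ρ) ^ 2 / (2 * (2 * ρ * (2 * 3 : ℕ) + 1)) / ((max r 1 + 2 : ℕ) : ℝ)) := by
  have e4 : (2 : ℝ) * (((3 : ℕ) : ℝ) - 1) = 4 := by norm_num
  have e4' : (2 : ℝ) * ((3 : ℕ) : ℝ) - 2 = 4 := by norm_num
  have e12 : (4 : ℝ) * ((3 : ℕ) : ℝ) * lam = 12 * lam := by push_cast; ring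
  have h := torusClusteringOnBallUpTo_of_robustStar_variance (d := 3) (N := N) (by norm_num) hN r Kn hcP hv
    (βs := βs) (b := b) (by rw [e4]; exact hb) hP hVB hε₁ hc hlam (by rw [e4']; exact hθ) hθ1 hcd (by rw [e12]; exact hρ) hρ1
  exact clusterDomainClustering_of_torusClusteringOnBallUpTo h

/-- **Y4, `d = 3`, tier 2, variance form**: `ClusterDomainClustering` on the weighted ball `ClusterDomain κ ε₀ ε₁` up to `β⋆` at rate `t`. [folklore] -/
theorem clusterDomainClusteringW_dim3_of_robustStar_variance (hN : 1 ≤ N) {βs κ ε₀ ε₁ b cP v c lam θ ρ t : ℝ}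
    (Kn : ℕ) (hcP : 0 ≤ cP) (hv : 0 ≤ v) (hb : βs / N * 4 ≤ b) (hP : OneLinkPoincareSUN N b cP)
    (hVB : OneLinkVarianceBound N b v) (hε₁ : 0 ≤ ε₁) (ht : 0 ≤ t) (htκ : t ≤ κ)
    (hc : Real.exp ε₀ * Real.sqrt (cP * v) * (βs / N) ≤ c) (hlam : Real.exp (ε₀ / 2) * Real.sqrt cP * ε₁ ≤ lam)
    (hθ : θ = 4 * c + lam) (hθ1 : θ < 1) (hcd : doorPoly 3 c < 1)
    (hρ : ρ = Real.exp t * (gaugeR 3 c +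
      (Real.exp (2 * t) * lam + θ ^ Kn * (12 * (Real.exp (2 * t) * lam))) / (1 - θ))) (hρ1 : ρ < 1) :
    YM3IR.ClusterDomainClustering (G := SUN N)
      ⟨fundamentalRep (Fin N), βs, fun _ _ W => W ∈ ClusterDomain κ ε₀ ε₁⟩ suFrobDist t := by
  have e4 : (2 : ℝ) * (((3 : ℕ) : ℝ) - 1) = 4 := by norm_num
  have e4' : (2 : ℝ) * ((3 : ℕ) : ℝ) - 2 = 4 := by norm_num
  have e12 : (4 : ℝ) * ((3 : ℕ) : ℝ) * (Real.exp (2 * t) * lam) = 12 * (Real.exp (2 * t) * lam) := by push_cast; ring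
  have h := torusClusteringOnBallW_upTo_of_robustStar_variance (d := 3) (N := N) (by norm_num) hN Kn hcP hv
    (βs := βs) (b := b) (by rw [e4]; exact hb) hP hVB hε₁ ht htκ hc hlam (by rw [e4']; exact hθ) hθ1 hcd (by rw [e12]; exact hρ) hρ1
  exact clusterDomainClustering_of_torusClusteringOnBallW h

end Summit.Ventures.YMGap.RobustBall

end
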